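import Summits.QuantumAdvantage.QuantumAdvantage.Theorems.LinnikCubicClassGroupsDegreeOnePrimesEscapeResidueBrauerSiegel
import Literature.NumberTheory.LFunctions.TatuzawaTheorem
import HarnessLib

/-!
# Tatuzawa–Stark: zero repulsion and the Brauer–Siegel lower bound, with EXPLICIT constants, for
# every number field of degree `n` avoiding ONE quadratic field

Topic `Summits/QuantumAdvantage/QuantumAdvantage/Theorems`, cell B2b-1 (linnik-cubic), PART A (gen 26);
helper toward the crux `DegreeOnePrimesEscape` (stmt-QuantumAdvantage-11543) of route
`LinnikCubicClassGroups`.  HONEST FRAMING: the value of this file is a THEOREM (kernel-checked, with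
explicit — hence effective — constants) — NOT summit progress (the route still rests on the
hypothesis-type target `PureCubicClassNumberHard`; in even degree the obstruction to
`DegreeOnePrimesEscape`-type statements is the Siegel zero of a quadratic subfield, and this file says
that at each scale `ε` that obstruction is carried by at most ONE quadratic field).

The tree's Brauer–Siegel lower bound `Residue.residue_ge_rpow_neg` (`κ_K ≥ C(n,ε)|d_K|^{-ε}`, every
`K` of degree `n`) is INEFFECTIVE (Siegel's theorem, `Classical.em`).  Combining
* Stark's Theorem 3 in locating form (`exists_quadratic_dedekindZetaCont_eq_zero`: a real zero
  `β ≥ 1 − 1/(4·n!·log|d_K|)` of `ζ_K` is a zero of `ζ_k` for a quadratic subfield `k ⊆ K`, hence of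
  `L(s, κ_k)` for the primitive Kronecker character `κ_k` mod `|d_k|`,
  `Quadratic.exists_primitive_LFunction_eq_zero_of_realZero`), and
* Tatuzawa's theorem with the tree's explicit constant (`Siegel.tatuzawa_of_ne`,
  `Literature/…/TatuzawaTheorem.lean`: `Re L(1,χ) ≥ C_T ε³ q^{-ε}` for all primitive quadratic `χ`
  except those of at most one modulus),
we obtain, with the EXPLICIT constant `C(n,ε) = C_T·ε⁵/(1000·n!)`, `C_T = c_E/(2592·B)`
(`c_E = estermannC`, `B = ballConst`; written out in every statement, no new definition):

* `exists_quadraticSubfield_tatuzawa_violator` — if `ζ_K(β) = 0` with `1 − β < C(n,ε)|d_K|^{-ε}` then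
  `K` contains a quadratic field `k` with `ζ_k(β) = 0` whose Kronecker character VIOLATES Tatuzawa's
  bound at level `ε' = 4ε/5` (mean value: `L(1,κ_k) ≤ (1−β)·288|d_K|^{ε'/4}/ε'²`);
* `natAbs_discr_quadraticSubfield_eq_of_close_zeros` — two number fields (of any degrees `> 1`) with
  such close zeros contain quadratic subfields of the SAME absolute discriminant;
* `exists_tatuzawa_exceptional_absDiscr` — **for `0 < ε ≤ 1` there is ONE natural number `M₀ = M₀(ε)`
  such that for every `n > 1` and every number field `K` of degree `n` none of whose quadratic
  subfields has `|d_k| = M₀` (in particular every `K` without quadratic subfield), every real zero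
  `β < 1` of `ζ_K` satisfies `1 − β ≥ C(n,ε)·|d_K|^{-ε}`**;
* `…_residue` / `…_classNumber` — for the same fields **`κ_K ≥ e^{-7}16^{-n}(C(n,ε)/2)|d_K|^{-ε}`**
  (Stark's Lemma 4, `Residue.residue_ge_of_zeroFree`) and **`h_K R_K ≥ e^{-7}(32π)^{-n}(C(n,ε)/2)|d_K|^{1/2−ε}`**.
`M₀` is chosen classically, but no constant depends on it: Brauer–Siegel at fixed degree made effective
up to one exceptional quadratic field per scale `ε` [Tatuzawa1951] [Stark1974, Thm. 3, Lemma 4]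
[MontgomeryVaughan2007, §11.2 Ex. 6].  0 sorries, standard axioms.
-/

noncomputable section

open Complex NumberField NumberField.Units Module

namespace Summit.QuantumAdvantage.QuantumAdvantage.Theorems.DegreeOnePrimesEscape

open Literature.NumberTheory.LFunctions Literature.NumberTheory.LFunctions.NumberField
  Literature.NumberTheory.LFunctions.Siegel Literature.NumberTheory.QuadraticFields

/-- `c_E ≤ 1/2` (`c_E = ½·exp(−(1/4 + log 528/(4 log(6/5))))`, an exponential of a negative number).
[folklore] -/
theorem estermannC_le_half : Estermann.estermannC ≤ 1 / 2 := by
  unfold Estermann.estermannC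
  have h1 : 0 < Real.log 528 := Real.log_pos (by norm_num)
  have h2 : 0 < Real.log (6 / 5) := Real.log_pos (by norm_num)
  have h3 : Real.exp (-(1 / 4 + Real.log 528 / (4 * Real.log (6 / 5)))) ≤ 1 := by
    rw [Real.exp_le_one_iff]
    have : 0 < Real.log 528 / (4 * Real.log (6 / 5)) := by positivity
    linarith
  linarith

/-- `C_T = c_E/(2592·B) ≤ 1`. [folklore] -/
theorem tatuzawa_const_le_one : Estermann.estermannC / (2592 * ballConst) ≤ 1 := by
  have hB := one_le_ballConst
  have hc := estermannC_le_half
  rw [div_le_one (by positivity)]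
  nlinarith

/-- `ε·log d ≤ d^ε` for `d > 0` (from `log y ≤ y − 1`). [folklore] -/
theorem eps_mul_log_le_rpow {d ε : ℝ} (hd : 0 < d) : ε * Real.log d ≤ d ^ ε := by
  have h := Real.log_le_sub_one_of_pos (Real.rpow_pos_of_pos hd ε)
  rw [Real.log_rpow hd] at h
  linarith

/-- **A close real zero of `ζ_K` produces a quadratic subfield violating Tatuzawa's bound.**  Let `K`
have degree `n > 1`, `0 < ε ≤ 1`, and let `β < 1` be a real zero of `ζ_K` with
`1 − β < C(n,ε)·|d_K|^{-ε}`.  Then there is a quadratic subfield `k ⊆ K` with `ζ_k(β) = 0` whose primitive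
Kronecker character `κ` mod `M = |d_k|` satisfies `Re L(1, κ) < C_T ε'³ M^{-ε'}`, `ε' = 4ε/5`.
Proof: the hypothesis puts `β` in Stark's window (`C ≤ ε/(4·n!)`, `ε log d ≤ d^ε`); Stark's Theorem 3
gives `k`; `|d_k| ≤ |d_K|`; the mean-value bound `Siegel.norm_LFunction_one_le_of_realZero` with
`r = ε'/16 = ε/20 ≥ 1 − β` gives `L(1,κ) ≤ (1−β)·288|d_K|^{ε'/4}/ε'²`, and `C ≤ C_T ε'⁵/288`,
`|d_K|^{-ε}|d_K|^{ε'/4} = |d_K|^{-ε'} ≤ M^{-ε'}`. [cite: Stark1974, Theorem 3] [cite: Tatuzawa1951, Theorem 2]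
[cite: MontgomeryVaughan2007, §11.2 Exercise 6 (c)] -/
theorem exists_quadraticSubfield_tatuzawa_violator (K : Type) [Field K] [NumberField K]
    (hK : 1 < finrank ℚ K) {ε : ℝ} (hε : 0 < ε) (hε1 : ε ≤ 1) {β : ℝ} (hβ1 : β < 1)
    (h0 : dedekindZetaCont K β = 0)
    (hclose : 1 - β < (Estermann.estermannC / (2592 * ballConst) * ε ^ 5 / (1000 * ((finrank ℚ K).factorial : ℝ))) * ((discr K).natAbs : ℝ) ^ (-ε)) :
    ∃ k : IntermediateField ℚ K, finrank ℚ k = 2 ∧ dedekindZetaCont k β = 0 ∧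
      ∃ (M : ℕ) (_ : NeZero M) (κ : DirichletCharacter ℂ M), M = (discr k).natAbs ∧ κ ≠ 1 ∧
        κ ^ 2 = 1 ∧ κ.IsPrimitive ∧ κ.LFunction β = 0 ∧
        (κ.LFunction 1).re < Estermann.estermannC / (2592 * ballConst) * (4 * ε / 5) ^ 3 * (M : ℝ) ^ (-(4 * ε / 5)) := by
  set n : ℕ := finrank ℚ K with hn
  set d : ℝ := ((discr K).natAbs : ℝ) with hd
  have hdK : 3 ≤ (discr K).natAbs := three_le_natAbs_discr K hK
  have hd3 : (3 : ℝ) ≤ d := by rw [hd]; exact_mod_cast hdK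
  have hd0 : (0 : ℝ) < d := by linarith
  have hd1 : (1 : ℝ) ≤ d := by linarith
  have hlogd : 0 < Real.log d := Real.log_pos (by linarith)
  have hfac0 : (0 : ℝ) < (n.factorial : ℝ) := by exact_mod_cast Nat.factorial_pos n
  have hCT0 : 0 < Estermann.estermannC / (2592 * ballConst) := by
    have := Estermann.estermannC_pos; have := one_le_ballConst; positivity
  have hCT1 := tatuzawa_const_le_one
  set CT : ℝ := Estermann.estermannC / (2592 * ballConst) with hCTdef
  set C : ℝ := CT * ε ^ 5 / (1000 * (n.factorial : ℝ)) with hCdef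
  have hC0 : 0 < C := by positivity
  have hfac1 : (1 : ℝ) ≤ (n.factorial : ℝ) := by exact_mod_cast Nat.one_le_iff_ne_zero.mpr (Nat.factorial_ne_zero n)
  have hε4 : ε ^ 4 ≤ 1 := by
    have : ε ^ 4 ≤ 1 ^ 4 := pow_le_pow_left₀ hε.le hε1 4
    simpa using this
  have hCle1 : C ≤ CT * (4 * ε / 5) ^ 5 / 288 := by
    rw [hCdef]
    have h1 : CT * ε ^ 5 / (1000 * (n.factorial : ℝ)) ≤ CT * ε ^ 5 / 1000 := by
      apply div_le_div_of_nonneg_left (by positivity) (by norm_num)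
      nlinarith
    have h2 : CT * ε ^ 5 / 1000 ≤ CT * (4 * ε / 5) ^ 5 / 288 := by
      rw [show CT * (4 * ε / 5) ^ 5 / 288 = CT * ε ^ 5 * (1024 / 900000) by ring,
        show CT * ε ^ 5 / 1000 = CT * ε ^ 5 * (1 / 1000) by ring]
      exact mul_le_mul_of_nonneg_left (by norm_num) (by positivity)
    exact h1.trans h2
  have hCle2 : C ≤ ε / (4 * (n.factorial : ℝ)) := by
    rw [hCdef, div_le_div_iff₀ (by positivity) (by positivity)]
    -- `CT ε⁵ · 4 n! ≤ ε · 1000 n!`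
    have : CT * ε ^ 4 ≤ 1 := by nlinarith
    have h0 : (0 : ℝ) ≤ ε * (n.factorial : ℝ) := by positivity
    nlinarith
  have hCle3 : C ≤ ε / 20 := by
    rw [hCdef, div_le_div_iff₀ (by positivity) (by norm_num)]
    have : CT * ε ^ 4 ≤ 1 := by nlinarith
    have h0 : (0 : ℝ) ≤ ε := hε.le
    nlinarith
  have hdε1 : d ^ (-ε) ≤ 1 := Real.rpow_le_one_of_one_le_of_nonpos hd1 (by linarith)
  have hdε0 : 0 < d ^ (-ε) := Real.rpow_pos_of_pos hd0 _
  have h1βC : 1 - β < C := by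
    calc 1 - β < C * d ^ (-ε) := hclose
      _ ≤ C * 1 := mul_le_mul_of_nonneg_left hdε1 hC0.le
      _ = C := mul_one C
  -- Step 1: `β` lies in Stark's window `1 − 1/(4·n!·log d) ≤ β`
  have hwin : 1 - 1 / (4 * (n.factorial : ℝ) * Real.log d) ≤ β := by
    have hlog : ε * Real.log d ≤ d ^ ε := eps_mul_log_le_rpow hd0
    have key : ε / (4 * (n.factorial : ℝ)) * d ^ (-ε) ≤ 1 / (4 * (n.factorial : ℝ) * Real.log d) := by
      rw [Real.rpow_neg hd0.le, le_div_iff₀ (by positivity)]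
      have hdε : 0 < d ^ ε := Real.rpow_pos_of_pos hd0 ε
      calc ε / (4 * (n.factorial : ℝ)) * (d ^ ε)⁻¹ * (4 * (n.factorial : ℝ) * Real.log d)
          = (ε * Real.log d) * (d ^ ε)⁻¹ := by field_simp
        _ ≤ d ^ ε * (d ^ ε)⁻¹ := mul_le_mul_of_nonneg_right hlog (by positivity)
        _ = 1 := mul_inv_cancel₀ hdε.ne'
    have : C * d ^ (-ε) ≤ ε / (4 * (n.factorial : ℝ)) * d ^ (-ε) :=
      mul_le_mul_of_nonneg_right hCle2 hdε0.le
    linarith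
  -- Step 2: Stark's descent to a quadratic subfield and its Kronecker character
  obtain ⟨k, hk2, hkζ⟩ := exists_quadratic_dedekindZetaCont_eq_zero K hK hwin hβ1 h0
  have hβ0 : 0 < β := by linarith
  obtain ⟨M, hM0, κ, hM, h3M, hκ1, hκsq, hκp, hκzero⟩ :=
    Quadratic.exists_primitive_LFunction_eq_zero_of_realZero hk2 hβ0 hβ1 hkζ
  refine ⟨k, hk2, hkζ, M, hM0, κ, hM, hκ1, hκsq, hκp, hκzero, ?_⟩
  -- Step 3: `M = |d_k| ≤ |d_K| = d`
  have hMd : (M : ℝ) ≤ d := by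
    have hdvd := natAbs_discr_pow_finrank_dvd k K
    have hpos : 0 < finrank k K := finrank_pos
    have h1 : (discr k).natAbs ∣ (discr K).natAbs := (dvd_pow_self _ hpos.ne').trans hdvd
    have h2 : (discr k).natAbs ≤ (discr K).natAbs := Nat.le_of_dvd (by omega) h1
    rw [hM, hd]; exact_mod_cast h2
  have hM3 : (3 : ℝ) ≤ M := by exact_mod_cast h3M
  have hM0r : (0 : ℝ) < M := by linarith
  -- Step 4: the mean-value bound for `L(1, κ)`
  set ε' : ℝ := 4 * ε / 5 with hε'def
  have hε'0 : 0 < ε' := by positivity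
  have hε'1 : ε' ≤ 1 := by rw [hε'def]; linarith
  set r : ℝ := ε' / 16 with hrdef
  have hr : 0 < r := by positivity
  have hr1 : r ≤ 1 / 8 := by rw [hrdef]; linarith
  have hrε : r = ε / 20 := by rw [hrdef, hε'def]; ring
  have hβr : 1 - r ≤ β := by rw [hrε]; linarith
  have hmv := norm_LFunction_one_le_of_realZero κ hκ1 hr hr1 hβr hκzero
  set Z : ℝ := ∑' m : ℕ, ((m + 1 : ℕ) : ℝ) ^ (-(1 + 2 * r)) with hZdef
  have hZ0 : 0 ≤ Z := tsum_nonneg fun m ↦ by positivity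
  have hZle : Z ≤ 9 / ε' := by
    have h := tsum_succ_rpow_neg_sub_one_le (δ := 2 * r) (by positivity)
    have e : ∀ m : ℕ, ((m + 1 : ℕ) : ℝ) ^ (-(2 * r) - 1) = ((m + 1 : ℕ) : ℝ) ^ (-(1 + 2 * r)) := by
      intro m; congr 1; ring
    rw [tsum_congr e] at h
    have h1ε : (1 : ℝ) ≤ 1 / ε' := one_le_one_div hε'0 hε'1
    have h8 : 1 / (2 * r) = 8 * (1 / ε') := by rw [hrdef]; field_simp; ring
    have : 1 + 1 / (2 * r) ≤ 9 / ε' := by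
      rw [h8, show (9 : ℝ) / ε' = 9 * (1 / ε') by ring]; linarith
    exact h.trans this
  have hM4r : (M : ℝ) ^ (4 * r) ≤ d ^ (ε' / 4) := by
    rw [show 4 * r = ε' / 4 by rw [hrdef]; ring]
    exact Real.rpow_le_rpow hM0r.le hMd (by positivity)
  have hdq : 0 < d ^ (ε' / 4) := Real.rpow_pos_of_pos hd0 _
  have hL1 : ‖κ.LFunction 1‖ ≤ (1 - β) * (288 * d ^ (ε' / 4) / ε' ^ 2) := by
    have hβ' : 0 ≤ 1 - β := by linarith
    calc ‖κ.LFunction 1‖ ≤ (1 - β) * (2 * (M : ℝ) ^ (4 * r) * Z / r) := hmv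
      _ ≤ (1 - β) * (2 * d ^ (ε' / 4) * (9 / ε') / r) := by
          gcongr
      _ = (1 - β) * (288 * d ^ (ε' / 4) / ε' ^ 2) := by
          rw [hrdef]; field_simp; ring
  -- Step 5: compare with Tatuzawa's threshold at level `ε'`
  have hpow : d ^ (-ε) * d ^ (ε' / 4) = d ^ (-ε') := by
    rw [← Real.rpow_add hd0]; congr 1; rw [hε'def]; ring
  have hMε : d ^ (-ε') ≤ (M : ℝ) ^ (-ε') := Real.rpow_le_rpow_of_nonpos hM0r hMd (by linarith)
  have hfinal : (1 - β) * (288 * d ^ (ε' / 4) / ε' ^ 2) <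
      Estermann.estermannC / (2592 * ballConst) * ε' ^ 3 * d ^ (-ε') := by
    have h1 : (1 - β) * (288 * d ^ (ε' / 4) / ε' ^ 2) <
        C * d ^ (-ε) * (288 * d ^ (ε' / 4) / ε' ^ 2) :=
      mul_lt_mul_of_pos_right hclose (by positivity)
    have h2 : C * d ^ (-ε) * (288 * d ^ (ε' / 4) / ε' ^ 2) ≤
        (Estermann.estermannC / (2592 * ballConst) * ε' ^ 5 / 288) * d ^ (-ε) * (288 * d ^ (ε' / 4) / ε' ^ 2) := by
      gcongr
    have h3 : (Estermann.estermannC / (2592 * ballConst) * ε' ^ 5 / 288) * d ^ (-ε) * (288 * d ^ (ε' / 4) / ε' ^ 2) =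
        Estermann.estermannC / (2592 * ballConst) * ε' ^ 3 * (d ^ (-ε) * d ^ (ε' / 4)) := by
      field_simp
    rw [h3, hpow] at h2
    exact h1.trans_le h2
  calc (κ.LFunction 1).re ≤ ‖κ.LFunction 1‖ := Complex.re_le_norm _
    _ ≤ (1 - β) * (288 * d ^ (ε' / 4) / ε' ^ 2) := hL1
    _ < Estermann.estermannC / (2592 * ballConst) * ε' ^ 3 * d ^ (-ε') := hfinal
    _ ≤ Estermann.estermannC / (2592 * ballConst) * ε' ^ 3 * (M : ℝ) ^ (-ε') :=
        mul_le_mul_of_nonneg_left hMε (by positivity)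

/-- **Two number fields with close real zeros contain quadratic subfields of the same absolute
discriminant.**  For `0 < ε ≤ 1`, number fields `K`, `K'` of degrees `> 1` and real zeros `β` of `ζ_K`,
`β'` of `ζ_{K'}` with `1 − β < C([K:ℚ],ε)|d_K|^{-ε}` and `1 − β' < C([K':ℚ],ε)|d_{K'}|^{-ε}`, there are
quadratic subfields `k ⊆ K`, `k' ⊆ K'` with `ζ_k(β) = 0`, `ζ_{k'}(β') = 0` and `|d_k| = |d_{k'}|`
(their Kronecker characters both violate Tatuzawa's bound at level `4ε/5`, so by `Siegel.tatuzawa_of_ne`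
their moduli coincide). [cite: Tatuzawa1951, Theorem 2] [cite: Stark1974, Theorem 3] -/
theorem natAbs_discr_quadraticSubfield_eq_of_close_zeros {ε : ℝ} (hε : 0 < ε) (hε1 : ε ≤ 1)
    (K : Type) [Field K] [NumberField K] (hK : 1 < finrank ℚ K)
    (K' : Type) [Field K'] [NumberField K'] (hK' : 1 < finrank ℚ K')
    {β : ℝ} (hβ1 : β < 1) (h0 : dedekindZetaCont K β = 0)
    (hclose : 1 - β < (Estermann.estermannC / (2592 * ballConst) * ε ^ 5 / (1000 * ((finrank ℚ K).factorial : ℝ))) * ((discr K).natAbs : ℝ) ^ (-ε))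
    {β' : ℝ} (hβ'1 : β' < 1) (h0' : dedekindZetaCont K' β' = 0)
    (hclose' : 1 - β' < (Estermann.estermannC / (2592 * ballConst) * ε ^ 5 / (1000 * ((finrank ℚ K').factorial : ℝ))) * ((discr K').natAbs : ℝ) ^ (-ε)) :
    ∃ (k : IntermediateField ℚ K) (k' : IntermediateField ℚ K'), finrank ℚ k = 2 ∧ finrank ℚ k' = 2 ∧
      dedekindZetaCont k β = 0 ∧ dedekindZetaCont k' β' = 0 ∧ (discr k).natAbs = (discr k').natAbs := by
  have hε' : 0 < 4 * ε / 5 := by positivity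
  have hε'1 : 4 * ε / 5 ≤ 1 := by linarith
  obtain ⟨k, hk2, hkζ, M, hM0, κ, hM, hκ1, hκsq, hκp, -, hviol⟩ :=
    exists_quadraticSubfield_tatuzawa_violator K hK hε hε1 hβ1 h0 hclose
  obtain ⟨k', hk'2, hk'ζ, M', hM'0, κ', hM', hκ'1, hκ'sq, hκ'p, -, hviol'⟩ :=
    exists_quadraticSubfield_tatuzawa_violator K' hK' hε hε1 hβ'1 h0' hclose'
  refine ⟨k, k', hk2, hk'2, hkζ, hk'ζ, ?_⟩
  rw [← hM, ← hM']
  by_contra hne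
  rcases tatuzawa_of_ne hε' hε'1 κ hκ1 hκsq hκp κ' hκ'1 hκ'sq hκ'p hne with h | h
  · exact absurd h hviol.not_ge
  · exact absurd h hviol'.not_ge

/-- **Tatuzawa–Stark zero repulsion with at most ONE exceptional quadratic field (explicit constant).**
For `0 < ε ≤ 1` there is a natural number `M₀ = M₀(ε)` such that for every number field `K` of degree
`n > 1` none of whose quadratic subfields `k` has `|d_k| = M₀` — in particular for every `K` without a
quadratic subfield — every real zero `β < 1` of `ζ_K` satisfies `C(n,ε)·|d_K|^{-ε} ≤ 1 − β`,
`C(n,ε) = C_T ε⁵/(1000·n!)` explicit.  (`M₀` is chosen classically; the constant does not depend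
on it.) [cite: Tatuzawa1951, Theorem 2] [cite: Stark1974, Theorem 3] -/
theorem exists_tatuzawa_exceptional_absDiscr {ε : ℝ} (hε : 0 < ε) (hε1 : ε ≤ 1) :
    ∃ M₀ : ℕ, ∀ (K : Type) [Field K] [NumberField K], 1 < finrank ℚ K →
      (∀ k : IntermediateField ℚ K, finrank ℚ k = 2 → (discr k).natAbs ≠ M₀) →
      ∀ β : ℝ, β < 1 → dedekindZetaCont K β = 0 →
        (Estermann.estermannC / (2592 * ballConst) * ε ^ 5 / (1000 * ((finrank ℚ K).factorial : ℝ))) * ((discr K).natAbs : ℝ) ^ (-ε) ≤ 1 - β := by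
  classical
  by_cases hex : ∃ (K₁ : Type) (_ : Field K₁) (_ : NumberField K₁) (β₁ : ℝ), 1 < finrank ℚ K₁ ∧
      β₁ < 1 ∧ dedekindZetaCont K₁ β₁ = 0 ∧
      1 - β₁ < (Estermann.estermannC / (2592 * ballConst) * ε ^ 5 / (1000 * ((finrank ℚ K₁).factorial : ℝ))) * ((discr K₁).natAbs : ℝ) ^ (-ε)
  · obtain ⟨K₁, _, _, β₁, hK₁, hβ₁1, h0₁, hclose₁⟩ := hex
    have hε' : 0 < 4 * ε / 5 := by positivity
    have hε'1 : 4 * ε / 5 ≤ 1 := by linarith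
    obtain ⟨k₁, hk₁2, -, M₁, _, κ₁, hM₁, hκ₁1, hκ₁sq, hκ₁p, -, hviol₁⟩ :=
      exists_quadraticSubfield_tatuzawa_violator K₁ hK₁ hε hε1 hβ₁1 h0₁ hclose₁
    refine ⟨M₁, fun K _ _ hK havoid β hβ1 h0 ↦ ?_⟩
    by_contra hlt
    push Not at hlt
    obtain ⟨k, hk2, -, M, _, κ, hM, hκ1, hκsq, hκp, -, hviol⟩ :=
      exists_quadraticSubfield_tatuzawa_violator K hK hε hε1 hβ1 h0 hlt
    have hne : M ≠ M₁ := by rw [hM]; exact havoid k hk2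
    rcases tatuzawa_of_ne hε' hε'1 κ hκ1 hκsq hκp κ₁ hκ₁1 hκ₁sq hκ₁p hne with h | h
    · exact absurd h hviol.not_ge
    · exact absurd h hviol₁.not_ge
  · push Not at hex
    refine ⟨0, fun K _ _ hK _ β hβ1 h0 ↦ hex K inferInstance inferInstance β hK hβ1 h0⟩

/-- **Effective Brauer–Siegel residue bound with at most ONE exceptional quadratic field.**  For
`0 < ε ≤ 1` there is `M₀ = M₀(ε) ∈ ℕ` such that for every number field `K` of degree `n > 1` none of whose
quadratic subfields has absolute discriminant `M₀`:
`κ_K ≥ e^{-7}·16^{-n}·(C(n,ε)/2)·|d_K|^{-ε}` — Stark's Lemma 4 (`Residue.residue_ge_of_zeroFree`) fed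
with the zero-free interval `[1 − C(n,ε)|d_K|^{-ε}/2, 1)` of `exists_tatuzawa_exceptional_absDiscr`.
All constants explicit. [cite: Stark1974, Lemma 4 and Theorem 3] [cite: Tatuzawa1951, Theorem 2] -/
theorem exists_tatuzawa_exceptional_absDiscr_residue {ε : ℝ} (hε : 0 < ε) (hε1 : ε ≤ 1) :
    ∃ M₀ : ℕ, ∀ (K : Type) [Field K] [NumberField K], 1 < finrank ℚ K →
      (∀ k : IntermediateField ℚ K, finrank ℚ k = 2 → (discr k).natAbs ≠ M₀) →
      Real.exp (-7) * (1 / 16 : ℝ) ^ finrank ℚ K * ((Estermann.estermannC / (2592 * ballConst) * ε ^ 5 / (1000 * ((finrank ℚ K).factorial : ℝ))) / 2) *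
          ((discr K).natAbs : ℝ) ^ (-ε) ≤ dedekindZeta_residue K := by
  obtain ⟨M₀, hM₀⟩ := exists_tatuzawa_exceptional_absDiscr hε hε1
  refine ⟨M₀, fun K _ _ hK havoid ↦ ?_⟩
  set n : ℕ := finrank ℚ K with hn
  set d : ℝ := ((discr K).natAbs : ℝ) with hd
  have hdK : 3 ≤ (discr K).natAbs := three_le_natAbs_discr K hK
  have hd3 : (3 : ℝ) ≤ d := by rw [hd]; exact_mod_cast hdK
  have hd0 : (0 : ℝ) < d := by linarith
  have hlogd : 0 < Real.log d := Real.log_pos (by linarith)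
  have hfac1 : (1 : ℝ) ≤ (n.factorial : ℝ) := by exact_mod_cast Nat.one_le_iff_ne_zero.mpr (Nat.factorial_ne_zero n)
  have hCT0 : 0 < Estermann.estermannC / (2592 * ballConst) := by
    have := Estermann.estermannC_pos; have := one_le_ballConst; positivity
  have hCT1 := tatuzawa_const_le_one
  set CT : ℝ := Estermann.estermannC / (2592 * ballConst) with hCTdef
  set C : ℝ := CT * ε ^ 5 / (1000 * (n.factorial : ℝ)) with hCdef
  have hC0 : 0 < C := by positivity
  have hε4 : ε ^ 4 ≤ 1 := by
    have : ε ^ 4 ≤ 1 ^ 4 := pow_le_pow_left₀ hε.le hε1 4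
    simpa using this
  have hCle2 : C ≤ ε / (4 * (n.factorial : ℝ)) := by
    rw [hCdef, div_le_div_iff₀ (by positivity) (by positivity)]
    have : CT * ε ^ 4 ≤ 1 := by nlinarith
    have h0 : (0 : ℝ) ≤ ε * (n.factorial : ℝ) := by positivity
    nlinarith
  have hdε0 : 0 < d ^ (-ε) := Real.rpow_pos_of_pos hd0 _
  -- the zero-free interval `[1 − c/log d, 1)`, `c = C d^{-ε} log d / 2`
  set c : ℝ := C * d ^ (-ε) * Real.log d / 2 with hcdef
  have hc0 : 0 < c := by positivity
  have hc4 : c ≤ 1 / 4 := by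
    have hlog : ε * Real.log d ≤ d ^ ε := eps_mul_log_le_rpow hd0
    have hdε : 0 < d ^ ε := Real.rpow_pos_of_pos hd0 ε
    -- `d^{-ε} log d ≤ 1/ε`
    have h1 : d ^ (-ε) * Real.log d ≤ 1 / ε := by
      rw [Real.rpow_neg hd0.le, le_div_iff₀ hε]
      calc (d ^ ε)⁻¹ * Real.log d * ε = (ε * Real.log d) * (d ^ ε)⁻¹ := by ring
        _ ≤ d ^ ε * (d ^ ε)⁻¹ := mul_le_mul_of_nonneg_right hlog (by positivity)
        _ = 1 := mul_inv_cancel₀ hdε.ne'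
    have h2 : c ≤ ε / (4 * (n.factorial : ℝ)) * (1 / ε) / 2 := by
      rw [hcdef]
      have : C * d ^ (-ε) * Real.log d = C * (d ^ (-ε) * Real.log d) := by ring
      rw [this]
      gcongr
    have h3 : ε / (4 * (n.factorial : ℝ)) * (1 / ε) / 2 = 1 / (8 * (n.factorial : ℝ)) := by
      field_simp; ring
    rw [h3] at h2
    calc c ≤ 1 / (8 * (n.factorial : ℝ)) := h2
      _ ≤ 1 / (8 * 1) := by gcongr
      _ ≤ 1 / 4 := by norm_num
  have hZ : ∀ σ : ℝ, 1 - c / Real.log d ≤ σ → σ < 1 → dedekindZetaCont K σ ≠ 0 := by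
    intro σ hσ hσ1 h0
    have h := hM₀ K hK havoid σ hσ1 h0
    have hcl : c / Real.log d = C * d ^ (-ε) / 2 := by
      rw [hcdef]; field_simp
    rw [hcl] at hσ
    have : 0 < C * d ^ (-ε) := by positivity
    linarith
  have hmain := Residue.residue_ge_of_zeroFree K hK hc0 hc4 hZ
  have hcl : c / Real.log d = C * d ^ (-ε) / 2 := by rw [hcdef]; field_simp
  rw [hcl] at hmain
  calc Real.exp (-7) * (1 / 16 : ℝ) ^ n * (C / 2) * d ^ (-ε)
      = Real.exp (-7) * (1 / 16 : ℝ) ^ n * (C * d ^ (-ε) / 2) := by ring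
    _ ≤ dedekindZeta_residue K := hmain

/-- **Effective Brauer–Siegel class-number bound with at most ONE exceptional quadratic field.**  For
`0 < ε ≤ 1` there is `M₀ = M₀(ε) ∈ ℕ` such that for every number field `K` of degree `n > 1` none of whose
quadratic subfields has absolute discriminant `M₀`:
`h_K · R_K ≥ e^{-7}·16^{-n}·(2π)^{-n}·(C(n,ε)/2)·|d_K|^{1/2 − ε}` (class number formula shape,
`Residue.classNumber_mul_regulator_ge_of_residue_ge`).  All constants explicit.
[cite: Stark1974, §1 and Theorem 3] [cite: Tatuzawa1951, Theorems 1–2] -/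
theorem exists_tatuzawa_exceptional_absDiscr_classNumber {ε : ℝ} (hε : 0 < ε) (hε1 : ε ≤ 1) :
    ∃ M₀ : ℕ, ∀ (K : Type) [Field K] [NumberField K], 1 < finrank ℚ K →
      (∀ k : IntermediateField ℚ K, finrank ℚ k = 2 → (discr k).natAbs ≠ M₀) →
      Real.exp (-7) * (1 / 16 : ℝ) ^ finrank ℚ K * ((Estermann.estermannC / (2592 * ballConst) * ε ^ 5 / (1000 * ((finrank ℚ K).factorial : ℝ))) / 2) *
          ((discr K).natAbs : ℝ) ^ (1 / 2 - ε) / (2 * Real.pi) ^ finrank ℚ K ≤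
        (classNumber K : ℝ) * regulator K := by
  obtain ⟨M₀, hM₀⟩ := exists_tatuzawa_exceptional_absDiscr_residue hε hε1
  refine ⟨M₀, fun K _ _ hK havoid ↦ ?_⟩
  have h := hM₀ K hK havoid
  have hC0 : 0 < (Estermann.estermannC / (2592 * ballConst) * ε ^ 5 /
      (1000 * ((finrank ℚ K).factorial : ℝ))) := by
    have := Estermann.estermannC_pos; have := one_le_ballConst
    have : (0 : ℝ) < ((finrank ℚ K).factorial : ℝ) := by exact_mod_cast Nat.factorial_pos _
    positivity
  have hd0 : (0 : ℝ) < ((discr K).natAbs : ℝ) := by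
    have := three_le_natAbs_discr K hK
    exact_mod_cast (show 0 < (discr K).natAbs by omega)
  have hmain := Residue.classNumber_mul_regulator_ge_of_residue_ge K (C := Real.exp (-7) *
    (1 / 16 : ℝ) ^ finrank ℚ K * ((Estermann.estermannC / (2592 * ballConst) * ε ^ 5 / (1000 * ((finrank ℚ K).factorial : ℝ))) / 2) * ((discr K).natAbs : ℝ) ^ (-ε))
    (by positivity) h
  have hsqrt : Real.sqrt |(discr K : ℝ)| = ((discr K).natAbs : ℝ) ^ (1 / 2 : ℝ) := by
    rw [Real.sqrt_eq_rpow, Nat.cast_natAbs, Int.cast_abs]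
  rw [hsqrt] at hmain
  have hpow : ((discr K).natAbs : ℝ) ^ (-ε) * ((discr K).natAbs : ℝ) ^ (1 / 2 : ℝ) =
      ((discr K).natAbs : ℝ) ^ (1 / 2 - ε) := by
    rw [← Real.rpow_add hd0]; congr 1; ring
  calc Real.exp (-7) * (1 / 16 : ℝ) ^ finrank ℚ K * ((Estermann.estermannC / (2592 * ballConst) * ε ^ 5 / (1000 * ((finrank ℚ K).factorial : ℝ))) / 2) *
          ((discr K).natAbs : ℝ) ^ (1 / 2 - ε) / (2 * Real.pi) ^ finrank ℚ K
      = Real.exp (-7) * (1 / 16 : ℝ) ^ finrank ℚ K * ((Estermann.estermannC / (2592 * ballConst) * ε ^ 5 / (1000 * ((finrank ℚ K).factorial : ℝ))) / 2) *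
          ((discr K).natAbs : ℝ) ^ (-ε) * ((discr K).natAbs : ℝ) ^ (1 / 2 : ℝ) /
          (2 * Real.pi) ^ finrank ℚ K := by rw [← hpow]; ring
    _ ≤ (classNumber K : ℝ) * regulator K := hmain

end Summit.QuantumAdvantage.QuantumAdvantage.Theorems.DegreeOnePrimesEscape

end
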